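import Literature.AnabelianGeometry.EtaleTheta.Discharge.Sec2Cor219iiiPullback
import HarnessLib

/-!
# [EtTh] Cor. 2.19 (iii), tower form (`ThetaEnvTower.Cor219_iii`, F-0650) — part 2d (GENERIC): the coboundary
# transport «`γ̃⁻¹ ∘ ∂d ∘ γ = ∂d'`» (hypothesis HCOB of part 2c) is a THEOREM, in both directions, over every §1 setting
# whose `Δ_Θ` has no `l`-torsion (proof-only)

S. Mochizuki, *The étale theta function and its Frobenioid-theoretic manifestations*, Publ. RIMS **45** (2009)
[EtTh], §2, Cor. 2.19 (iii), PRIMS PDF p. 65; Def. 2.13 p. 47 ("conjugation by an element of `μ_N` corresponds precisely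
to modifying a cocycle by a coboundary"); §1 p. 12 ("`(Ẑ(1) ≅) Δ_Θ`"); Prop. 2.12 (i) p. 45 ("`l · Δ_Θ`")
[cite: MochizukiEtTh2009, Cor 2.19(iii) p.65].

Cell `abc-iut`, seat abc-iut-C-hgal-2 (gen 6), K-L6 row «COR219III-G8b» (abc-iut-L6-lead §F v1.19bw (1)), file 1 of the
row; sequel of abc-iut-w4-d038's `Sec2Cor219iiiTransport` / `Sec2Cor219iiiPullback` / `Sec2Cor219iiiAssembly` (p470012,
p470633, p474712) per HOME/staging/L6/w4-d038/g9/COR219III-PART2-ROADMAP.md (items M3/M3′, here made GENERIC).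
PROOF-ONLY: no definition, no instance, no notation, no new named fact; abc-iut-L2-t8's `cobAt` / `lDeltaTheta` and the
part-2 toolkit (`lDeltaAut_conj`, `lDeltaAut_symm_conj`, `apply_mem_PiYdd`) consumed BY NAME, nothing restated.

WHAT IS SHOWN (`T := C.thetaEnvTower τ hC hS`; `γ` a bi-continuous automorphism of `Π^tp_X̲̲` with `γ(Π^tp_Ÿ̲̲) = Π^tp_Ÿ̲̲`,
`γ(θ⁻¹(l·Δ_Θ)) = θ⁻¹(l·Δ_Θ)`; `γ̃` an automorphism of `l·Δ_Θ` induced by `γ` (`exists_lDeltaAut`); binder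
`hT : ∀ t : Δ_Θ, t ^ l = 1 → t = 1` = «`Δ_Θ` has no `l`-torsion», a theorem at every origin by abc-iut-L2-t8's
`ThetaSetting.deltaTheta_torsionfree` with `DoubleUnderline.l_ne_zero`):
* §1 bookkeeping: `(∂d(t))^n = ∂(d^n)(t)`, `∂(d₁d₂) = ∂d₁ · ∂d₂` in the commutative `Δ_Θ`; `l·Δ_Θ` IS the group of `l`-th
  powers of `Δ_Θ` (definition of `lDeltaTheta`); under `hT`, `l`-th powers separate `Δ_Θ` (`eq_of_pow_eq_of_noTorsion`).
* §2 **HCOB, forward** (`transport_cobAt_of_noTorsion`): for EVERY `d ∈ Δ_Θ`, with `d' := (γ̃⁻¹(d^l))^{1/l}`,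
  `γ̃⁻¹(∂d(θ(γ g))) = ∂d'(θ g)` wherever `∂d(θ(γ g)) ∈ l·Δ_Θ` — compare `l`-th powers, which live in `l·Δ_Θ` where `γ̃⁻¹` is
  an equivariant homomorphism (`lDeltaAut_symm_conj`).  This is literally the hypothesis `hcob` of part 2c's
  `pullback_image_subset_of_heart`, so the ⊆ half needs NO model input M3/M3′.
* §2 **HCOB, backward** (`cobAt_transport_surjective_of_noTorsion`): every `d' ∈ Δ_Θ` with `l·Δ_Θ`-valued coboundary on
  `Π^tp_Ÿ̲̲` arises this way from `d := (γ̃(d'^l))^{1/l}`, whose coboundary is again `l·Δ_Θ`-valued on `Π^tp_Ÿ̲̲` — the input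
  of the ⊇ half (file 2 of the row, `Sec2Cor219iiiPullbackImageEq`).

HONEST FRAMING: unconditional statements about OUR typed objects over an arbitrary §1 setting; nothing of [EtTh] (refereed)
is asserted beyond what is proved; no side is taken on [IUTchIII] Cor. 3.12; typed ≠ proved; nothing asserts abc proved or
refuted.
-/

noncomputable section

namespace Literature.AnabelianGeometry.EtaleTheta

open Literature.AnabelianGeometry.SemiGraphs
open scoped IsMulCommutative

namespace ThetaSetting.EtaleThetaData.DoubleUnderline

variable {p : ℕ} [Fact p.Prime] {D : ThetaSetting p} {E : D.EtaleThetaData} {l : ℕ}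
  (C : E.DoubleUnderline l) {Es : Set ℕ+} (τ : D.CyclotomeTower l Es)

/-! ## §1. `l`-th powers in the commutative group `Δ_Θ` and coboundary values -/

/-- `(∂d(t))^n = ∂(d^n)(t)`: the coboundary value `∂d(t) = t d t⁻¹ · d⁻¹` is multiplicative in `d ∈ Δ_Θ` (`Δ_Θ` is
commutative). [cite: MochizukiEtTh2009, Prop 2.14 (ii) p.49] -/
theorem cobAt_pow (d : D.DeltaTheta) (t : D.GtpTheta) (n : ℕ) : cobAt d t ^ n = cobAt (d ^ n) t := by
  simp only [cobAt, map_pow, mul_pow, inv_pow]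

/-- `∂(d₁ d₂)(t) = ∂d₁(t) · ∂d₂(t)`. [cite: MochizukiEtTh2009, Prop 2.14 (ii) p.49] -/
theorem cobAt_mul_left (d₁ d₂ : D.DeltaTheta) (t : D.GtpTheta) :
    cobAt (d₁ * d₂) t = cobAt d₁ t * cobAt d₂ t := by
  simp only [cobAt, map_mul, mul_inv]
  exact mul_mul_mul_comm _ _ _ _

/-- `∂d(t)` in the ambient group `(Π^tp_X)^Θ`: `t · d · t⁻¹ · d⁻¹`. [cite: MochizukiEtTh2009, Prop 2.14 (ii) p.49] -/
theorem coe_cobAt (d : D.DeltaTheta) (t : D.GtpTheta) :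
    (cobAt d t : D.GtpTheta) = t * (d : D.GtpTheta) * t⁻¹ * (d : D.GtpTheta)⁻¹ := by
  simp only [cobAt, Subgroup.coe_mul, Subgroup.coe_inv, MulAut.conjNormal_apply]

/-- `d^l ∈ l·Δ_Θ` for `d ∈ Δ_Θ` (`l·Δ_Θ` is the group of `l`-th powers of `Δ_Θ`).
[cite: MochizukiEtTh2009, Prop 2.12 (i) p.45] -/
theorem coe_pow_mem_lDeltaTheta (d : D.DeltaTheta) : (d : D.GtpTheta) ^ l ∈ D.lDeltaTheta l :=
  ⟨d, d.2, rfl⟩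

/-- Every element of `l·Δ_Θ` is the `l`-th power of an element of `Δ_Θ` (definition of `lDeltaTheta`).
[cite: MochizukiEtTh2009, Prop 2.12 (i) p.45] -/
theorem exists_coe_pow_eq (y : D.lDeltaTheta l) : ∃ e : D.DeltaTheta, (e : D.GtpTheta) ^ l = (y : D.GtpTheta) := by
  obtain ⟨x, hx, hxy⟩ := y.2
  exact ⟨⟨x, hx⟩, hxy⟩

/-- **No `l`-torsion ⇒ `l`-th powers separate `Δ_Θ`**: two elements of `Δ_Θ` with the same `l`-th power coincide
(`Δ_Θ` commutative; "`(Ẑ(1) ≅) Δ_Θ`", p. 12). [cite: MochizukiEtTh2009, §1 p.12] -/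
theorem eq_of_pow_eq_of_noTorsion (hT : ∀ t : D.DeltaTheta, t ^ l = 1 → t = 1) {a b : D.GtpTheta}
    (ha : a ∈ D.DeltaTheta) (hb : b ∈ D.DeltaTheta) (h : a ^ l = b ^ l) : a = b := by
  have hab : (⟨a, ha⟩ * ⟨b, hb⟩⁻¹ : D.DeltaTheta) ^ l = 1 := by
    rw [mul_pow, inv_pow]
    apply Subtype.ext
    rw [Subgroup.coe_mul, Subgroup.coe_inv, Subgroup.coe_pow, Subgroup.coe_pow, Subgroup.coe_one, h,
      mul_inv_cancel]
  have h1 := congrArg (fun z : D.DeltaTheta => (z : D.GtpTheta)) (hT _ hab)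
  simp only [Subgroup.coe_mul, Subgroup.coe_inv, Subgroup.coe_one] at h1
  exact mul_inv_eq_one.1 h1

/-! ## §2. HCOB: transporting coboundaries of `Δ_Θ` along `γ` (roadmap M3′, GENERIC under no `l`-torsion) -/

section Tower

/-- **HCOB (forward) is a theorem under no `l`-torsion.** For `γ` with `γ(θ⁻¹(l·Δ_Θ)) = θ⁻¹(l·Δ_Θ)`, `γ̃` induced on
`l·Δ_Θ`, and ANY `d ∈ Δ_Θ`: with `d' ∈ Δ_Θ` the `l`-th root of `γ̃⁻¹(d^l)`, one has `γ̃⁻¹(∂d(θ(γ g))) = ∂d'(θ g)` at every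
`g ∈ Π^tp_Ÿ̲̲` where `∂d(θ(γ g)) ∈ l·Δ_Θ` (compare `l`-th powers: `γ̃⁻¹(∂(d^l)(θ(γ g))) = ∂(γ̃⁻¹ d^l)(θ g)` by the
equivariance `lDeltaAut_symm_conj`).  This is the hypothesis HCOB of `pullback_image_subset_of_heart`, for all `d`.
[cite: MochizukiEtTh2009, Cor 2.19(iii) p.65] -/
theorem transport_cobAt_of_noTorsion (hC : D.Compat) (hS : D.Sec2Hyps)
    (hT : ∀ t : D.DeltaTheta, t ^ l = 1 → t = 1)
    (γ : (C.thetaEnvTower τ hC hS).PiX ≃ₜ* (C.thetaEnvTower τ hC hS).PiX)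
    (hγ : (C.thetaEnvTower τ hC hS).PiYdd.map γ.toMulEquiv.toMonoidHom = (C.thetaEnvTower τ hC hS).PiYdd)
    (hL : (C.thetaEnvTower τ hC hS).lDeltaTheta.map γ.toMulEquiv.toMonoidHom = (C.thetaEnvTower τ hC hS).lDeltaTheta)
    (γΛ : D.lDeltaTheta l ≃* D.lDeltaTheta l)
    (hγΛ : ∀ (g : (C.thetaEnvTower τ hC hS).lDeltaTheta) (hg : γ g ∈ (C.thetaEnvTower τ hC hS).lDeltaTheta),
      C.toLDelta ⟨γ g, hg⟩ = γΛ (C.toLDelta g))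
    (d : D.DeltaTheta) :
    ∃ d' : D.DeltaTheta, ∀ (g : (C.thetaEnvTower τ hC hS).PiYdd)
      (hmem : (cobAt d (D.toTheta ((C.inclYdduu ⟨γ g, C.apply_mem_PiYdd τ hC hS γ hγ g⟩ : C.GtpYdduu) :
        D.PiTemp)) : D.GtpTheta) ∈ D.lDeltaTheta l),
      (γΛ.symm ⟨_, hmem⟩ : D.GtpTheta) = (cobAt d' (D.toTheta ((C.inclYdduu g : C.GtpYdduu) : D.PiTemp)) : D.GtpTheta) := by
  -- `dl := d^l ∈ l·Δ_Θ`, `d' := (γ̃⁻¹ dl)^{1/l}`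
  set dl : D.lDeltaTheta l := ⟨(d : D.GtpTheta) ^ l, coe_pow_mem_lDeltaTheta d⟩ with hdl
  obtain ⟨d', hd'⟩ := exists_coe_pow_eq (γΛ.symm dl)
  refine ⟨d', fun g hmem => ?_⟩
  -- abbreviations for the two points of `(Π^tp_X)^Θ`
  set tγ : D.GtpTheta := D.toTheta ((C.inclYdduu ⟨γ g, C.apply_mem_PiYdd τ hC hS γ hγ g⟩ : C.GtpYdduu) : D.PiTemp)
    with htγ
  set t : D.GtpTheta := D.toTheta ((C.inclYdduu g : C.GtpYdduu) : D.PiTemp) with ht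
  -- compare `l`-th powers
  refine eq_of_pow_eq_of_noTorsion hT (D.lDeltaTheta_le l (γΛ.symm _).2) (cobAt d' t).2 ?_
  -- `(∂d(tγ))^l = tγ dl tγ⁻¹ · dl⁻¹` in `l·Δ_Θ`
  have hz : (⟨_, hmem⟩ : D.lDeltaTheta l) ^ l =
      ⟨tγ * (dl : D.GtpTheta) * tγ⁻¹, (D.lDeltaTheta_normal l).conj_mem _ dl.2 _⟩ * dl⁻¹ := by
    apply Subtype.ext
    rw [Subgroup.coe_pow, Subgroup.coe_mul, Subgroup.coe_inv, hdl]
    change (cobAt d tγ : D.GtpTheta) ^ l = tγ * ((d : D.GtpTheta) ^ l) * tγ⁻¹ * ((d : D.GtpTheta) ^ l)⁻¹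
    rw [← Subgroup.coe_pow, cobAt_pow, coe_cobAt, Subgroup.coe_pow]
  -- `tγ = θ(γ g)` in tower currency, so that `lDeltaAut_symm_conj` applies
  have hsymm : (γΛ.symm (⟨tγ * (dl : D.GtpTheta) * tγ⁻¹, (D.lDeltaTheta_normal l).conj_mem _ dl.2 _⟩) :
      D.GtpTheta) = t * (γΛ.symm dl : D.GtpTheta) * t⁻¹ := by
    have h := C.lDeltaAut_symm_conj τ hC hS γ hL γΛ hγΛ (g : (C.thetaEnvTower τ hC hS).PiX) dl
    exact congrArg Subtype.val h
  have hlhs : (γΛ.symm ⟨_, hmem⟩ : D.GtpTheta) ^ l =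
      t * (γΛ.symm dl : D.GtpTheta) * t⁻¹ * ((γΛ.symm dl : D.GtpTheta))⁻¹ := by
    rw [← Subgroup.coe_pow, ← map_pow, hz, map_mul, map_inv, Subgroup.coe_mul, Subgroup.coe_inv, hsymm]
  have hrhs : (cobAt d' t : D.GtpTheta) ^ l = t * ((d' : D.GtpTheta) ^ l) * t⁻¹ * ((d' : D.GtpTheta) ^ l)⁻¹ := by
    rw [← Subgroup.coe_pow, cobAt_pow, coe_cobAt, Subgroup.coe_pow]
  rw [hlhs, hrhs, hd']

/-- **HCOB (backward) is a theorem under no `l`-torsion.** Conversely, for ANY `d' ∈ Δ_Θ` whose coboundary is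
`l·Δ_Θ`-valued on `Π^tp_Ÿ̲̲` there is `d ∈ Δ_Θ` (the `l`-th root of `γ̃(d'^l)`) whose coboundary is again `l·Δ_Θ`-valued
on `Π^tp_Ÿ̲̲` and transports to `∂d'`: `γ̃⁻¹(∂d(θ(γ g))) = ∂d'(θ g)` — the coboundary transport along `γ` is ONTO.
[cite: MochizukiEtTh2009, Cor 2.19(iii) p.65] -/
theorem cobAt_transport_surjective_of_noTorsion (hC : D.Compat) (hS : D.Sec2Hyps)
    (hT : ∀ t : D.DeltaTheta, t ^ l = 1 → t = 1)
    (γ : (C.thetaEnvTower τ hC hS).PiX ≃ₜ* (C.thetaEnvTower τ hC hS).PiX)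
    (hγ : (C.thetaEnvTower τ hC hS).PiYdd.map γ.toMulEquiv.toMonoidHom = (C.thetaEnvTower τ hC hS).PiYdd)
    (hL : (C.thetaEnvTower τ hC hS).lDeltaTheta.map γ.toMulEquiv.toMonoidHom = (C.thetaEnvTower τ hC hS).lDeltaTheta)
    (γΛ : D.lDeltaTheta l ≃* D.lDeltaTheta l)
    (hγΛ : ∀ (g : (C.thetaEnvTower τ hC hS).lDeltaTheta) (hg : γ g ∈ (C.thetaEnvTower τ hC hS).lDeltaTheta),
      C.toLDelta ⟨γ g, hg⟩ = γΛ (C.toLDelta g))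
    (d' : D.DeltaTheta)
    (hd' : ∀ k : C.GtpYdduu, (cobAt d' (D.toTheta (k : D.PiTemp)) : D.GtpTheta) ∈ D.lDeltaTheta l) :
    ∃ d : D.DeltaTheta,
      (∀ k : C.GtpYdduu, (cobAt d (D.toTheta (k : D.PiTemp)) : D.GtpTheta) ∈ D.lDeltaTheta l) ∧
      ∀ g : (C.thetaEnvTower τ hC hS).PiYdd,
        ∃ hmem : (cobAt d (D.toTheta ((C.inclYdduu ⟨γ g, C.apply_mem_PiYdd τ hC hS γ hγ g⟩ : C.GtpYdduu) :
          D.PiTemp)) : D.GtpTheta) ∈ D.lDeltaTheta l,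
        (γΛ.symm ⟨_, hmem⟩ : D.GtpTheta) =
          (cobAt d' (D.toTheta ((C.inclYdduu g : C.GtpYdduu) : D.PiTemp)) : D.GtpTheta) := by
  -- `dl' := d'^l ∈ l·Δ_Θ`, `d := (γ̃ dl')^{1/l}`
  set dl' : D.lDeltaTheta l := ⟨(d' : D.GtpTheta) ^ l, coe_pow_mem_lDeltaTheta d'⟩ with hdl'
  obtain ⟨d, hd⟩ := exists_coe_pow_eq (γΛ dl')
  -- the key identity at a point `g ∈ Π^tp_Ÿ̲̲` (tower currency): `∂d(θ(γ g)) = γ̃(∂d'(θ g))`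
  have key : ∀ g : (C.thetaEnvTower τ hC hS).PiYdd,
      (cobAt d (D.toTheta ((C.inclYdduu ⟨γ g, C.apply_mem_PiYdd τ hC hS γ hγ g⟩ : C.GtpYdduu) : D.PiTemp)) :
        D.GtpTheta) =
        (γΛ ⟨cobAt d' (D.toTheta ((C.inclYdduu g : C.GtpYdduu) : D.PiTemp)), hd' _⟩ : D.GtpTheta) := by
    intro g
    set tγ : D.GtpTheta := D.toTheta ((C.inclYdduu ⟨γ g, C.apply_mem_PiYdd τ hC hS γ hγ g⟩ : C.GtpYdduu) : D.PiTemp)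
      with htγ
    set t : D.GtpTheta := D.toTheta ((C.inclYdduu g : C.GtpYdduu) : D.PiTemp) with ht
    refine eq_of_pow_eq_of_noTorsion hT (cobAt d tγ).2 (D.lDeltaTheta_le l (γΛ _).2) ?_
    -- `(∂d'(t))^l = t dl' t⁻¹ · dl'⁻¹` in `l·Δ_Θ`
    have hz : (⟨_, hd' (C.inclYdduu g)⟩ : D.lDeltaTheta l) ^ l =
        ⟨t * (dl' : D.GtpTheta) * t⁻¹, (D.lDeltaTheta_normal l).conj_mem _ dl'.2 _⟩ * dl'⁻¹ := by
      apply Subtype.ext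
      rw [Subgroup.coe_pow, Subgroup.coe_mul, Subgroup.coe_inv, hdl']
      change (cobAt d' t : D.GtpTheta) ^ l = t * ((d' : D.GtpTheta) ^ l) * t⁻¹ * ((d' : D.GtpTheta) ^ l)⁻¹
      rw [← Subgroup.coe_pow, cobAt_pow, coe_cobAt, Subgroup.coe_pow]
    have hfwd : (γΛ (⟨t * (dl' : D.GtpTheta) * t⁻¹, (D.lDeltaTheta_normal l).conj_mem _ dl'.2 _⟩) :
        D.GtpTheta) = tγ * (γΛ dl' : D.GtpTheta) * tγ⁻¹ :=
      C.lDeltaAut_conj τ hC hS γ.toMulEquiv hL γΛ hγΛ (g : (C.thetaEnvTower τ hC hS).PiX) dl'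
    have hlhs : (cobAt d tγ : D.GtpTheta) ^ l = tγ * ((d : D.GtpTheta) ^ l) * tγ⁻¹ * ((d : D.GtpTheta) ^ l)⁻¹ := by
      rw [← Subgroup.coe_pow, cobAt_pow, coe_cobAt, Subgroup.coe_pow]
    have hrhs : (γΛ ⟨_, hd' (C.inclYdduu g)⟩ : D.GtpTheta) ^ l =
        tγ * (γΛ dl' : D.GtpTheta) * tγ⁻¹ * ((γΛ dl' : D.GtpTheta))⁻¹ := by
      rw [← Subgroup.coe_pow, ← map_pow, hz, map_mul, map_inv, Subgroup.coe_mul, Subgroup.coe_inv, hfwd]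
    rw [hlhs, hrhs, hd]
  -- every `k ∈ Π^tp_Ÿ̲̲` is `γ g`
  have hsurj : ∀ k : C.GtpYdduu, ∃ g : (C.thetaEnvTower τ hC hS).PiYdd,
      (C.inclYdduu ⟨γ g, C.apply_mem_PiYdd τ hC hS γ hγ g⟩ : C.GtpYdduu) = k := by
    intro k
    let k' : (C.thetaEnvTower τ hC hS).PiYdd := ⟨⟨(k : D.PiTemp), (Subgroup.mem_inf.1 k.2).2⟩, (Subgroup.mem_inf.1 k.2).1⟩
    have hk' : (k' : (C.thetaEnvTower τ hC hS).PiX) ∈ (C.thetaEnvTower τ hC hS).PiYdd.map γ.toMulEquiv.toMonoidHom := by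
      rw [hγ]; exact k'.2
    obtain ⟨g₀, hg₀, hg₀eq⟩ := hk'
    refine ⟨⟨g₀, hg₀⟩, Subtype.ext ?_⟩
    exact congrArg (fun z : (C.thetaEnvTower τ hC hS).PiX => (z : D.PiTemp)) hg₀eq
  have hmemγ : ∀ g : (C.thetaEnvTower τ hC hS).PiYdd,
      (cobAt d (D.toTheta ((C.inclYdduu ⟨γ g, C.apply_mem_PiYdd τ hC hS γ hγ g⟩ : C.GtpYdduu) : D.PiTemp)) :
        D.GtpTheta) ∈ D.lDeltaTheta l := fun g => by
    rw [key g]; exact (γΛ _).2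
  refine ⟨d, fun k => ?_, fun g => ⟨hmemγ g, ?_⟩⟩
  · obtain ⟨g, hg⟩ := hsurj k
    rw [← hg]
    exact hmemγ g
  · have h : (⟨_, hmemγ g⟩ : D.lDeltaTheta l) =
        γΛ ⟨cobAt d' (D.toTheta ((C.inclYdduu g : C.GtpYdduu) : D.PiTemp)), hd' _⟩ := Subtype.ext (key g)
    rw [h, MulEquiv.symm_apply_apply]

end Tower

end ThetaSetting.EtaleThetaData.DoubleUnderline

end Literature.AnabelianGeometry.EtaleTheta

end
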